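import Summits.Ventures.PercRepro.S2ThirteenEightSpread
import Summits.Ventures.PercRepro.S2TwelveEightK1Spread
import Summits.Ventures.PercRepro.S2ElevenEightK2Spread

/-!
# PercRepro — S2: THE CELL `(13, 8)` MODULO ITS THREE `ν = 4` CASES (p7, gen 17)

The coloop-free cell `(13, 8)` (S2ThirteenEightSpread), its scaled coloop-free sub-cell `(12, 8)` at `K₁` (S2TwelveEightK1Spread) and its
twice-scaled sub-cell `(11, 8)` at `K₂` (S2ElevenEightK2Spread) are each theorems modulo their case `ν = 4` (a set of nullity `4` on `≤ 9`
points, no smaller-corank witness): **`c025_core_five_thirteen_eight_of_nu_four (hnu4₁₃) (hnu4₁₂) (hnu4₁₁) : RLS M 13 5`** — THE CELL `(13, 8)`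
MODULO ITS THREE `ν = 4` CASES. Nothing about the cell is claimed. Axioms: standard.
-/

open scoped Matroid

namespace PercRepro

namespace ThmN

open Set

variable {α : Type}

/-- **The cell `(13, 8)` modulo its three `ν = 4` cases** (every other case of the cell and of its two sub-cells is a theorem). -/
theorem c025_core_five_thirteen_eight_of_nu_four
    (hnu4 : ∀ (M : Matroid α) [M.Finite], M.eRank = ((13 : ℕ) : ℕ∞) → M.E.ncard = 13 + 8 →
      (∀ e ∈ M.E, ∃ A ⊆ M.E \ {e}, e ∉ M.closure A ∧ e ∉ M.closure ((M.E \ {e}) \ A)) → (∀ e, ¬ M.IsColoop e) →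
      ¬ (∃ W ⊆ M.E, W.ncard ≤ 12 ∧ W.encard = M.eRk W + 7) → ¬ (∃ W ⊆ M.E, W.ncard ≤ 11 ∧ W.encard = M.eRk W + 6) →
      ¬ (∃ W ⊆ M.E, W.ncard ≤ 10 ∧ W.encard = M.eRk W + 5) → (∃ W ⊆ M.E, W.ncard ≤ 9 ∧ W.encard = M.eRk W + 4) → RLS M 13 5)
    (hnu4₁₂ : ∀ (M : Matroid α) [M.Finite], M.eRank = ((12 : ℕ) : ℕ∞) → M.E.ncard = 12 + 8 →
      (∀ e ∈ M.E, ∃ A ⊆ M.E \ {e}, e ∉ M.closure A ∧ e ∉ M.closure ((M.E \ {e}) \ A)) → (∀ e, ¬ M.IsColoop e) →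
      ¬ (∃ W ⊆ M.E, W.ncard ≤ 12 ∧ W.encard = M.eRk W + 7) → ¬ (∃ W ⊆ M.E, W.ncard ≤ 11 ∧ W.encard = M.eRk W + 6) →
      ¬ (∃ W ⊆ M.E, W.ncard ≤ 10 ∧ W.encard = M.eRk W + 5) → (∃ W ⊆ M.E, W.ncard ≤ 9 ∧ W.encard = M.eRk W + 4) →
      ((phiK 13 5 - 2) / 2) * (Matroid.topCount M 12 5 : ℚ) ≤ (Matroid.midCount M 12 5 : ℚ))
    (hnu4₁₁ : ∀ (M : Matroid α) [M.Finite], M.eRank = ((11 : ℕ) : ℕ∞) → M.E.ncard = 11 + 8 →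
      (∀ e ∈ M.E, ∃ A ⊆ M.E \ {e}, e ∉ M.closure A ∧ e ∉ M.closure ((M.E \ {e}) \ A)) →
      ¬ (∃ W ⊆ M.E, W.ncard ≤ 12 ∧ W.encard = M.eRk W + 7) → ¬ (∃ W ⊆ M.E, W.ncard ≤ 11 ∧ W.encard = M.eRk W + 6) →
      ¬ (∃ W ⊆ M.E, W.ncard ≤ 10 ∧ W.encard = M.eRk W + 5) → (∃ W ⊆ M.E, W.ncard ≤ 9 ∧ W.encard = M.eRk W + 4) →
      ((phiK 13 5 - 6) / 4) * (Matroid.topCount M 11 5 : ℚ) ≤ (Matroid.midCount M 11 5 : ℚ))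
    (M : Matroid α) [M.Finite]
    (hR : M.eRank = ((13 : ℕ) : ℕ∞)) (hn : M.E.ncard = 13 + 8)
    (hfree : ∀ e ∈ M.E, ∃ A ⊆ M.E \ {e}, e ∉ M.closure A ∧ e ∉ M.closure ((M.E \ {e}) \ A)) : RLS M 13 5 :=
  c025_core_five_thirteen_eight_of_nu_four_of_cells hnu4 (c025_twelve_eight_cfk1_of_nu_four hnu4₁₂)
    (c025_eleven_eight_k2_of_nu_four hnu4₁₁) M hR hn hfree

end ThmN

end PercRepro
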